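import Literature.Computability.Complexity.KWDepthHardFunctions
import Literature.Computability.Complexity.CircuitCounting
import Mathlib.Data.Fintype.BigOperators
import Mathlib.Data.Fintype.Powerset
import Mathlib.Data.Nat.Choose.Sum
import HarnessLib

/-!
# `SliceMonoHardExist` holds — the P1 rung of the crux idea `slice-semimonotone` (stmt-PneNP-18538)

Theorems landing (statements and proofs byte-faithful) of the crux work file
`Cruxes/StrongComposition/SliceMonoHard.lean` for `Summit.PneNP.PneNP.Theses.KrwChromaticSteering.StrongComposition`
(stmt-PneNP-18538), seat pnp-ideate-p5 (gen 2).  FRONTIER material: nothing here bears on `P ≠ NP`;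
it discharges the SUPPORT RUNG `P1 = SliceMonoHardExist` of the idea card
`Cruxes/StrongComposition/Ideas/slice-semimonotone.md` / `Cruxes/StrongComposition/SliceSemiMonotone.lean`
(there: `sliceMonoHardExist_of_sliceStrongComposition : SliceStrongComposition → SliceMonoHardExist`, i.e.
P1 is the `m = 1` shadow of the host conjecture C₀; P1 was left OPEN, "M-sized counting").

**Statement proved** (`sliceMonoHardExist_holds`, constant `c = 8`): for every `n ≥ 1` some SLICE function
`h : {0,1}ⁿ → {0,1}` (`h ≡ 0` below weight `k`, `h ≡ 1` above weight `k`, free on the layer `k = ⌊n/2⌋`)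
needs monotone Karchmer–Wigderson protocols of depth `≥ n − 8(⌊log₂ n⌋ + 1)`.  So the hypothesis class of
C₀ (one hard middle slice per arity) is NON-VACUOUS AT FULL STRENGTH `n − O(log n)`: the `∃ h` of C₀ can
only be instantiated by slices that are themselves depth-hard, and such slices exist.

**Proof** (Riordan–Shannon counting through Karchmer–Wigderson, the tree's pipeline of
`Literature/…/KWDepthHardFunctions.lean` restricted to one layer): a monotone protocol is a general one
(`KWTree.SolvesMono.solves`); a depth-`d` protocol gives a `B2`-circuit with `≤ 2^{d+1} − 1` gates
(`KWTree.exists_circuit_of_solves`), hence a code in `CircuitCount.Code n S`, `S + 1 = 2^{d+1}`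
(`CircuitCount.exists_code`); the `2^{C(n,⌊n/2⌋)}` slice functions `sliceOf k φ` are pairwise distinct
(`sliceOf_injective`), so if all of them had depth-`d` protocols we would get an injection
`({s // |s| = k} → Bool) ↪ Code n S`, contradicting `#Code n S < 2^{C(n,⌊n/2⌋)}` for
`S + 1 = 2^{n − 2⌊log₂ n⌋ − 6}`, `n ≥ 16` (`card_code_lt_two_pow_choose`, from `CircuitCount.card_code_le`
and `2ⁿ ≤ (n+1)·C(n,⌊n/2⌋)`).  Lengths `n ≤ 15` are covered by the constant.

The three definitions `wt`, `IsSlice`, `SliceMonoHardExist` are VERBATIM copies (same bodies) of the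
ones in `Cruxes/StrongComposition/SliceSemiMonotone.lean` (namespace `…SliceSemiMonotone`), which is a
crux work file and not an importable module on the farm; co-imported, the two `SliceMonoHardExist` are
definitionally equal (`Iff.rfl`).

References: [JuknaBFC2012] S. Jukna, *Boolean Function Complexity* (2012), Thm. 1.23 (Riordan–Shannon),
§3.3 Thm. 3.13 / Claim 3.15 (protocol ⟹ formula); I. Wegener, *The Complexity of Boolean Functions*
(1987), §6.13–6.14 (slice functions; almost all `k`-slices are hard, Berkowitz 1982).
-/

set_option linter.dupNamespace false
set_option autoImplicit false

open Literature.Computability.Complexity Finset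

namespace Summit.PneNP.PneNP.Theorems.KrwChromaticSteeringSliceMonoHard

/-! ### The three definitions (verbatim from `SliceSemiMonotone.lean`) -/

/-- Hamming weight of a Boolean vector. [folklore] -/
def wt {n : ℕ} (x : Fin n → Bool) : ℕ := (Finset.univ.filter fun j => x j = true).card

/-- `h` is a `k`-SLICE function: `0` below weight `k`, `1` above weight `k` (free on the layer).
[cite: Wegener1987, §6.13 (slice functions, Berkowitz 1982)] -/
def IsSlice {n : ℕ} (k : ℕ) (h : (Fin n → Bool) → Bool) : Prop :=
  ∀ x, (wt x < k → h x = false) ∧ (k < wt x → h x = true)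

/-- **P1.** Some slice function of each arity needs monotone KW depth `≥ n − c·(log₂ n + 1)`. -/
def SliceMonoHardExist : Prop :=
  ∃ c : ℕ, ∀ n : ℕ, 1 ≤ n → ∃ k : ℕ, ∃ h : (Fin n → Bool) → Bool, IsSlice k h ∧
    ∀ T : KWTree (Fin n), T.SolvesMono h → n ≤ T.depth + c * (Nat.log 2 n + 1)

/-! ### Slice functions with prescribed values on one layer -/

/-- The support of a Boolean vector. [folklore] -/
def supp {n : ℕ} (x : Fin n → Bool) : Finset (Fin n) := Finset.univ.filter fun j => x j = true

/-- Weight = size of the support. [folklore] -/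
theorem wt_eq_card_supp {n : ℕ} (x : Fin n → Bool) : wt x = (supp x).card := rfl

/-- The `k`-slice function whose values on the layer `{x : wt x = k}` are given by `φ`
(indexed by the supports, i.e. by the `k`-subsets of the coordinates). [folklore] -/
def sliceOf {n : ℕ} (k : ℕ) (φ : {s : Finset (Fin n) // s.card = k} → Bool) :
    (Fin n → Bool) → Bool :=
  fun x => if hk : (supp x).card = k then φ ⟨supp x, hk⟩ else decide (k < (supp x).card)

/-- `sliceOf k φ` is a `k`-slice function. [folklore] -/
theorem isSlice_sliceOf {n k : ℕ} (φ : {s : Finset (Fin n) // s.card = k} → Bool) :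
    IsSlice k (sliceOf k φ) := by
  intro x
  refine ⟨fun hlt => ?_, fun hgt => ?_⟩
  · have hne : (supp x).card ≠ k := by rw [← wt_eq_card_supp]; omega
    have hnk : ¬ k < (supp x).card := by rw [← wt_eq_card_supp]; omega
    simp [sliceOf, hne, hnk]
  · have hne : (supp x).card ≠ k := by rw [← wt_eq_card_supp]; omega
    have hk : k < (supp x).card := by rw [← wt_eq_card_supp]; exact hgt
    simp [sliceOf, hne, hk]

/-- The support of the indicator vector of `s` is `s`. [folklore] -/
theorem supp_indicator {n : ℕ} (s : Finset (Fin n)) : supp (fun j => decide (j ∈ s)) = s := by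
  ext j
  simp [supp]

/-- On the indicator vector of a `k`-set the slice function takes the prescribed value. [folklore] -/
theorem sliceOf_indicator {n k : ℕ} (φ : {s : Finset (Fin n) // s.card = k} → Bool)
    (s : {s : Finset (Fin n) // s.card = k}) :
    sliceOf k φ (fun j => decide (j ∈ s.1)) = φ s := by
  have hs : supp (fun j => decide (j ∈ s.1)) = s.1 := supp_indicator s.1
  have hk : (supp (fun j => decide (j ∈ s.1))).card = k := by rw [hs]; exact s.2
  have : (⟨supp (fun j => decide (j ∈ s.1)), hk⟩ : {s : Finset (Fin n) // s.card = k}) = s :=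
    Subtype.ext hs
  simp only [sliceOf, hk, ↓reduceDIte]
  rw [this]

/-- Distinct layer data give distinct slice functions. [folklore] -/
theorem sliceOf_injective {n k : ℕ} :
    Function.Injective (sliceOf (n := n) k) := by
  intro φ ψ h
  funext s
  rw [← sliceOf_indicator φ s, ← sliceOf_indicator ψ s, h]

/-- A `k`-slice with `k < n` is `1` at the all-ones vector. [folklore] -/
theorem sliceOf_const_true {n k : ℕ} (hk : k < n) (φ : {s : Finset (Fin n) // s.card = k} → Bool) :
    sliceOf k φ (fun _ => true) = true := by
  have hsupp : supp (fun _ : Fin n => true) = Finset.univ := by ext j; simp [supp]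
  have hcard : (supp (fun _ : Fin n => true)).card = n := by rw [hsupp]; simp
  have hne : (supp (fun _ : Fin n => true)).card ≠ k := by omega
  have hlt : k < (supp (fun _ : Fin n => true)).card := by omega
  simp [sliceOf, hne, hlt]

/-- A `k`-slice with `0 < k` is `0` at the all-zeros vector. [folklore] -/
theorem sliceOf_const_false {n k : ℕ} (hk : 0 < k) (φ : {s : Finset (Fin n) // s.card = k} → Bool) :
    sliceOf k φ (fun _ => false) = false := by
  have hsupp : supp (fun _ : Fin n => false) = ∅ := by ext j; simp [supp]
  have hcard : (supp (fun _ : Fin n => false)).card = 0 := by rw [hsupp]; simp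
  have hne : (supp (fun _ : Fin n => false)).card ≠ k := by omega
  have hlt : ¬ k < (supp (fun _ : Fin n => false)).card := by omega
  simp [sliceOf, hne, hlt]

/-- There are `2^{C(n,k)}` choices of layer data. [folklore] -/
theorem card_layerData (n k : ℕ) :
    Fintype.card ({s : Finset (Fin n) // s.card = k} → Bool) = 2 ^ n.choose k := by
  classical
  rw [Fintype.card_fun, Fintype.card_bool, Fintype.card_finset_len, Fintype.card_fin]

/-! ### Counting: few small circuits against many slice functions -/

/-- The middle binomial coefficient carries a `1/(n+1)` fraction of `2ⁿ`. [folklore] -/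
theorem two_pow_le_succ_mul_choose_middle (n : ℕ) : 2 ^ n ≤ (n + 1) * n.choose (n / 2) := by
  have h := Nat.sum_range_choose n
  have : ∑ k ∈ Finset.range (n + 1), n.choose k ≤ ∑ _k ∈ Finset.range (n + 1), n.choose (n / 2) :=
    Finset.sum_le_sum fun k _ => Nat.choose_le_middle k n
  simpa [h] using this

/-- `2⌊log₂ n⌋ + 8 ≤ n` for `n ≥ 16`. [folklore] -/
theorem two_mul_log_add_eight_le {n : ℕ} (hn : 16 ≤ n) : 2 * Nat.log 2 n + 8 ≤ n := by
  have key : ∀ L : ℕ, 4 ≤ L → 2 * L + 8 ≤ 2 ^ L := by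
    intro L hL
    induction L, hL using Nat.le_induction with
    | base => norm_num
    | succ L hL ih =>
      have h2 : 2 ≤ 2 ^ L := by
        calc (2 : ℕ) = 2 ^ 1 := by norm_num
          _ ≤ 2 ^ L := Nat.pow_le_pow_right (by norm_num) (by omega)
      rw [pow_succ]; omega
  have hL : 4 ≤ Nat.log 2 n := Nat.le_log_of_pow_le (by norm_num) (by norm_num; omega)
  have hpow : 2 ^ Nat.log 2 n ≤ n := Nat.pow_log_le_self 2 (by omega)
  have := key _ hL
  omega

/-- **Riordan–Shannon count against one layer**: for `n ≥ 16` and `S + 1 = 2^{n − 2⌊log₂ n⌋ − 6}` there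
are fewer codes of `B2`-circuits of size `≤ S` on `n` inputs than `⌊n/2⌋`-slice functions:
`#Code n S < 2^{C(n,⌊n/2⌋)}`. [cite: JuknaBFC2012, Thm. 1.23 (Riordan–Shannon); Wegener1987, §6.14] -/
theorem card_code_lt_two_pow_choose {n S : ℕ} (hn : 16 ≤ n)
    (hS : S + 1 = 2 ^ (n - (2 * Nat.log 2 n + 6))) :
    Fintype.card (CircuitCount.Code n S) < 2 ^ n.choose (n / 2) := by
  set t := 2 * Nat.log 2 n + 6 with ht
  have htn : t + 2 ≤ n := by have := two_mul_log_add_eight_le hn; omega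
  set M := n + S + 1 with hM
  -- `#Code ≤ (S+1) (16 M²)^S M ≤ (16 M²)^(S+1)`
  have h16 : (S + 1) * M ≤ 16 * M ^ 2 := by nlinarith
  have hcard : Fintype.card (CircuitCount.Code n S) ≤ (16 * M ^ 2) ^ (S + 1) := by
    calc Fintype.card (CircuitCount.Code n S)
        ≤ (S + 1) * (16 * M ^ 2) ^ S * M := CircuitCount.card_code_le n S
      _ = (16 * M ^ 2) ^ S * ((S + 1) * M) := by ring
      _ ≤ (16 * M ^ 2) ^ S * (16 * M ^ 2) := Nat.mul_le_mul_left _ h16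
      _ = (16 * M ^ 2) ^ (S + 1) := by ring
  -- `M ≤ 2ⁿ`, so `16 M² ≤ 2^(2n+4)`
  have h2n : 2 ^ n = 2 * 2 ^ (n - 1) := by
    rw [← pow_succ']; congr 1; omega
  have hS1 : S + 1 ≤ 2 ^ (n - 1) := by
    rw [hS]; exact Nat.pow_le_pow_right (by norm_num) (by omega)
  have hn1 : n ≤ 2 ^ (n - 1) := by
    have := Nat.lt_two_pow_self (n := n - 1)
    omega
  have hMle : M ≤ 2 ^ n := by omega
  have h16M : 16 * M ^ 2 ≤ 2 ^ (2 * n + 4) := by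
    have : 2 ^ (2 * n + 4) = 16 * (2 ^ n) ^ 2 := by ring
    rw [this]
    gcongr
  -- the exponent: `(2n+4)(S+1)(n+1) < 2ⁿ ≤ (n+1) C(n, n/2)`
  have hlog : n < 2 ^ (Nat.log 2 n + 1) := Nat.lt_pow_succ_log_self (by norm_num) n
  have hsq : (2 * n + 4) * (n + 1) ≤ 2 ^ (t - 2) := by
    have h1 : n + 1 ≤ 2 * 2 ^ Nat.log 2 n := by rw [pow_succ] at hlog; omega
    have h2 : (2 * n + 4) * (n + 1) ≤ 4 * (n + 1) ^ 2 := by nlinarith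
    have h3 : 4 * (n + 1) ^ 2 ≤ 16 * (2 ^ Nat.log 2 n) ^ 2 := by nlinarith
    have h4 : 2 ^ (t - 2) = 16 * (2 ^ Nat.log 2 n) ^ 2 := by
      rw [ht, show 2 * Nat.log 2 n + 6 - 2 = Nat.log 2 n * 2 + 4 by omega, pow_add, pow_mul]
      ring
    omega
  have hexp' : (2 * n + 4) * (S + 1) * (n + 1) < 2 ^ n := by
    calc (2 * n + 4) * (S + 1) * (n + 1) = ((2 * n + 4) * (n + 1)) * (S + 1) := by ring
      _ ≤ 2 ^ (t - 2) * (S + 1) := Nat.mul_le_mul_right _ hsq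
      _ = 2 ^ (t - 2) * 2 ^ (n - t) := by rw [hS]
      _ = 2 ^ (n - 2) := by rw [← pow_add]; congr 1; omega
      _ < 2 ^ n := Nat.pow_lt_pow_right (by norm_num) (by omega)
  have hexp : (2 * n + 4) * (S + 1) < n.choose (n / 2) := by
    have hmid := two_pow_le_succ_mul_choose_middle n
    have : (n + 1) * ((2 * n + 4) * (S + 1)) < (n + 1) * n.choose (n / 2) := by
      calc (n + 1) * ((2 * n + 4) * (S + 1)) = (2 * n + 4) * (S + 1) * (n + 1) := by ring
        _ < 2 ^ n := hexp'
        _ ≤ (n + 1) * n.choose (n / 2) := hmid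
    exact Nat.lt_of_mul_lt_mul_left this
  calc Fintype.card (CircuitCount.Code n S) ≤ (16 * M ^ 2) ^ (S + 1) := hcard
    _ ≤ (2 ^ (2 * n + 4)) ^ (S + 1) := Nat.pow_le_pow_left h16M _
    _ = 2 ^ ((2 * n + 4) * (S + 1)) := by rw [← pow_mul]
    _ < 2 ^ n.choose (n / 2) := Nat.pow_lt_pow_right (by norm_num) hexp

/-! ### Assembly -/

/-- **Depth-hard slice functions exist** (`SliceMonoHardExist` with `c = 8`): for `n ≥ 16` some
`⌊n/2⌋`-slice function has no monotone Karchmer–Wigderson protocol of depth `< n − 2⌊log₂ n⌋ − 7`;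
small `n` by the constant. [cite: JuknaBFC2012, Thm. 1.23, Thm. 3.13; Wegener1987, §6.14 (almost all
slice functions are hard, Berkowitz 1982)] -/
theorem sliceMonoHardExist_holds : SliceMonoHardExist := by
  classical
  refine ⟨8, fun n hn => ?_⟩
  by_cases hsmall : n ≤ 15
  · refine ⟨0, fun _ => true, fun x => ⟨fun h => absurd h (Nat.not_lt_zero _), fun _ => rfl⟩,
      fun T _ => ?_⟩
    by_cases h8 : n ≤ 8
    · nlinarith [Nat.zero_le (Nat.log 2 n), Nat.zero_le T.depth]
    · have hlog : 0 < Nat.log 2 n := Nat.log_pos (by norm_num) (by omega)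
      nlinarith [Nat.zero_le T.depth]
  have hn16 : 16 ≤ n := by omega
  set t := 2 * Nat.log 2 n + 6 with ht
  have htn : t + 2 ≤ n := by have := two_mul_log_add_eight_le hn16; omega
  have hpow1 : 1 ≤ 2 ^ (n - t) := Nat.one_le_two_pow
  set S := 2 ^ (n - t) - 1 with hSdef
  have hS : S + 1 = 2 ^ (n - (2 * Nat.log 2 n + 6)) := by rw [← ht]; omega
  have hcard := card_code_lt_two_pow_choose hn16 hS
  -- Suppose every `⌊n/2⌋`-slice `sliceOf (n / 2) φ` had a shallow monotone protocol.
  by_contra hcon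
  have hall : ∀ φ : {s : Finset (Fin n) // s.card = n / 2} → Bool,
      ∃ T : KWTree (Fin n), T.SolvesMono (sliceOf (n / 2) φ) ∧ T.depth + 8 * (Nat.log 2 n + 1) < n := by
    intro φ
    by_contra hφ
    push Not at hφ
    exact hcon ⟨n / 2, sliceOf (n / 2) φ, isSlice_sliceOf φ, hφ⟩
  -- Each such protocol yields a code of a `B2`-circuit of size `≤ S` computing the slice function.
  have key : ∀ φ : {s : Finset (Fin n) // s.card = n / 2} → Bool,
      ∃ c : CircuitCount.Code n S, CircuitCount.decode c = sliceOf (n / 2) φ := by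
    intro φ
    obtain ⟨T, hT, hd⟩ := hall φ
    have h1 : ∃ a, sliceOf (n / 2) φ a = true := ⟨fun _ => true, sliceOf_const_true (by omega) φ⟩
    have h0 : ∃ b, sliceOf (n / 2) φ b = false := ⟨fun _ => false, sliceOf_const_false (by omega) φ⟩
    obtain ⟨C, hO, hC, hsize⟩ := T.exists_circuit_of_solves hT.solves h1 h0
    have hdepth : T.depth + 1 ≤ n - t := by omega
    have hpow : 2 ^ (T.depth + 1) ≤ 2 ^ (n - t) := Nat.pow_le_pow_right (by norm_num) hdepth
    have hs : C.size ≤ S := by omega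
    obtain ⟨c, hc⟩ := CircuitCount.exists_code C hO hs
    exact ⟨c, by rw [hc]; funext x; exact hC x⟩
  choose F hF using key
  have hinj : Function.Injective F := by
    intro φ ψ hφψ
    apply sliceOf_injective
    rw [← hF φ, ← hF ψ, hφψ]
  have hle := Fintype.card_le_of_injective F hinj
  rw [card_layerData] at hle
  omega

end Summit.PneNP.PneNP.Theorems.KrwChromaticSteeringSliceMonoHard
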